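import Literature.MathematicalPhysics.QuantumFieldTheory.Balaban1983to89.B15Prop1AnalyticExtClause
import Literature.Analysis.Complex.HolomorphicParametricIntegral
import Literature.Analysis.Complex.OsgoodProofs

/-!
# `Balaban1983to89.B15Prop1SliceTaylorCalculus` — [Balaban1989LargeFieldII] p. 359: *«We expand the function with respect to B′ … Now the
# condition for a critical configuration is the equation (1.12)»* — COORDINATE CALCULUS ON THE GAUGE-FIXED SLICE: the TAYLOR DATA of a real
# function of the coordinates `B′` (gradient, Hessian, second-order remainder of the gradient), their complexification on `B′ ∈ 𝔤ᶜ`, and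
# the PROPOSITION-4-SHAPED bound of the complex remainder from CAUCHY's estimates

statement-level skeleton of published theorems with citation tags; proofs where landed; nothing here is a claim about
the Yang–Mills mass gap

Cell pub-ymgap, HUMAN RULING D-0062 (Track A full width), seat `pub-ymgap-dag-n12-c` (R134 acceleration seat (a), strategy s1 of DAG node
N12 = [B15]; generation g5, first product).  PDFs held: `paper:balaban1989-cmp122-large-field-ii` (p. 359 = PDF 5, text layer re-read this
session: *«we consider the variational problem for the function V′↾_Λ → A(U_{k,Z}(V′Ṽ_k)) … Fixing the gauge G₀ for V′ we get a small
configuration, and we can write V′ = exp iB′. We expand the function with respect to B′, the expansion has the same form as in the exponentials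
in (1.2) … Now the condition for a critical configuration is the equation ⟨δB′, H*_{1,k}J_{k,Z}⟩ + ⟨δB′, H*_{1,k}Δ₁H_{1,k}B′⟩ +
⟨δB′, H*_{1,k}(δ/δA)V(H_{1,k}B′)⟩ = 0 (1.12) … The above equations, bounds and statements are valid for 𝔤ᶜ-valued fields»*),
`paper:balaban1989-cmp122-large-field-i` (Prop. 1 p. 194).

PURPOSE (the INTRINSIC READING of (1.11)–(1.12), used by the sequel `B15Prop1IntrinsicReading`).  The N12∕s1 chain (endpoint
`B15Prop1LocalLettersRecord.exists_domain_prop1Printed_lfVarOn_std_su2_box_regular`, p501043) displays print's expansion pieces `H_{1,k}`, `J`,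
`Δ₁(ζ₀)`, `(δ/δA)V` as abstract data with letters.  Print's (1.12) is the vanishing of the derivative of its function `g(B′) =
A(U_{k,Z}(exp(iB′)Ṽ_k))` of the gauge-fixed coordinates `B′` *«expanded with respect to B′»*; so the chain can be INSTANTIATED at `H := id` with
`J`, `Δ₁`, `(δ/δA)V` THE TAYLOR DATA OF `g` AT `B′ = 0` — by (1.11) these are print's `H*J`, `H*Δ₁(ζ₀)H`, `H*(δ/δA)V(H·)` (Proposition 4 [15]
makes `(δ/δA)V` of second order, so the Hessian of `g` at `0` is the form of (1.7)).  This file supplies the coordinate calculus for that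
instantiation on the concrete slice `GaugeSlice S T ℝ³` (`B15Prop1SliceCoordinates`, p468327) and its complexification `GaugeSlice S T ℂ³`
(`B15Prop1AnalyticExtClause.cplxSlice`, p504654).

WHAT THIS FILE DOES (Mathlib + the three imports; no `sorry`, no `… : Prop` fact, no `instance`, no `notation`; the `def`s are concrete
objects with bodies; axioms standard).
§1 COORDINATES: `basisR`∕`basisC` (coordinate vectors), `inner_eq_sum_real`, `sum_repr_real`∕`sum_repr_cplx`, `apply_eq_sum_real`∕`_cplx`
   (a linear functional is the coordinate pairing with its values on the coordinate vectors).
§2 COORDINATE RIESZ MAPS AND GRADIENTS: `rieszR`∕`rieszC` (continuous linear: functional ↦ vector of its values on coordinate vectors;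
   `ℂ`-LINEAR on the complex side — the bilinear, not the sesquilinear, pairing), `inner_rieszR` (`⟪δ, rieszR ℓ⟫ = ℓ δ`), `rGrad g X := rieszR
   (Dg(X))`, `cGrad G Y := rieszC (DG(Y))`, `inner_rGrad`, ★ `hasDerivAt_line_rGrad` (the chain's (m5)∕`hA` shape: `d/ds g(X + sδ)|₀ = ⟪δ, ∇g(X)⟫`),
   `norm_cGrad_le` (`‖cGrad G Y‖ ≤ ‖DG(Y)‖`, by pairing with the conjugate vector).
§3 REAL POINTS OF A HOLOMORPHIC EXTENSION: for `G` complex-differentiable near `cplxSlice X` with `G ∘ cplxSlice = g` near `X`: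
   `differentiableAt_of_cplx`, `fderiv_cplxSlice_apply` (`DG(ιX)(ιu) = Dg(X)u`), ★ `cGrad_cplxSlice` (`cGrad G (ιX) = ι(rGrad g X)`), and at second
   order on a ball ★ `fderiv_cGrad_cplxSlice` (`D(cGrad G)(0)(ιu) = ι(D(rGrad g)(0)u)`; `g` is `C²` there as the real part of a holomorphic map).
§4 ★★ `prop4Hyp_taylorRemainder` — THE PROPOSITION-4 SHAPE FROM CAUCHY's ESTIMATES: if `G` is complex-differentiable on `‖Y‖ < R` and bounded by
   `𝓐` there, the second-order Taylor remainder `W(Y) = cGrad G Y − cGrad G 0 − D(cGrad G)(0)Y` of its gradient satisfies r08's typed [15] Prop. 4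
   hypothesis `B11Prop6Scheme.Prop4Hyp W (64𝓐/R³) (R/2)` — by the tree's Cauchy estimate `Literature.Analysis.Complex.norm_fderiv_le_of_forall_mem_ball_norm_le`
   and second-order Schwarz estimate `…norm_sub_sub_fderiv_le_of_forall_mem_ball_norm_le` BY NAME (Mathlib's `Complex.dist_le_mul_div_pow_of_mapsTo_ball_of_isLittleO`).
§5 FROM BOND FIELDS TO THE SLICE: `ιAc` (the `ℂ`-linear extension by zero `GaugeSlice S T ℂ³ → (bonds → ℂ³)`, `ιAc_cplxSlice : ιAc (ι B) = cplxVec (ιA B)`,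
   `norm_ιAc_le`), `cplxVecL` (the `ℝ`-linear `cplxVec` as a continuous linear map), `norm_ιA_le`, `sliceFn S T f V := B ↦ f(exp(i·ιA B)·V)` (print's
   function in the gauge-fixed coordinates), and ★★ `slice_package_of_holomorphic`: from ONE holomorphic extension `G` of `B′ ↦ f(exp(iB′)·V)` to the
   sup-ball `‖B′‖ < R` of `𝔤ᶜ`-valued bond fields, bounded by `𝓐` — (a) real differentiability of `B′ ↦ f(exp(iB′)·V)` at the chart points `ιA B`,
   `‖B‖ < R` (the chain's `hG`); (b) the first-variation formula with the Taylor data (the chain's `hA` at `H = id`); (c) `Prop4Hyp` of the complex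
   remainder on the slice (the chain's `hW`); (d) the remainder restricts to the real one (`hWdV` on the ball).

HONEST SCOPE.  Pure finite-dimensional calculus; nothing of Bałaban's is proved here beyond bookkeeping, and no object of NODE 00 is declared: the
Taylor data are those of whatever function is supplied.  The identification of these data with print's `H*_{1,k}J_{k,Z}`, `H*_{1,k}Δ₁(ζ₀)H_{1,k}`,
`H*_{1,k}(δ/δA)V(H_{1,k}·)` is (1.11) itself and is not used as a hypothesis anywhere — the sequel's letters speak of the Taylor data directly.
Count-neutral; NOT a discharge of N12; NOT summit progress; nothing continuum ∕ OS ∕ mass-gap ∕ Clay.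
-/

noncomputable section

open Set Metric Filter
open scoped InnerProductSpace BigOperators Topology

namespace Literature.MathematicalPhysics.QuantumFieldTheory.Balaban1983to89.B15Prop1SliceTaylorCalculus

open B15DeterminingSets GaugeField B15Prop1Carrier B16Sect1Backgrounds
open B15Prop1SliceCoordinates (GaugeSlice ιA freeBonds norm_ιA_apply_le ιA_apply_of_mem ιA_apply_of_not_mem)
open B15Prop1AnalyticExtClause (cplxVec cplxSlice cplxSlice_apply norm_cplxSlice norm_cplxVec norm_cplxVec_apply reSlice)
open B15Prop1ChartCalculusSU2 (E3)
open B15Prop1ChartSU2 (su2Chart)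
open T4CubeChartGnomonic (SU2)
open B11Prop6Scheme (Prop4Hyp)
open Literature.Analysis.Complex (norm_fderiv_le_of_forall_mem_ball_norm_le norm_sub_sub_fderiv_le_of_forall_mem_ball_norm_le)

variable {P : Params} {k : ℕ} [DecidableEq (PBond P k)]

/-! ## §1 Coordinates on the real and the complexified slice -/

section Coordinates

variable (S : Set (Site P k)) (T : Finset (PBond P k))

/-- The COORDINATE VECTOR `e_{b,j}` of the real slice: `1` at the free bond `b`, Lie-algebra component `j`, `0` elsewhere (print's variables
`B′(b) ∈ 𝔤 = ℝ³`, p. 359). [cite: Balaban1989LargeFieldII, p.359] -/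
def basisR (b : ↥(freeBonds S T)) (j : Fin 3) : GaugeSlice S T E3 :=
  WithLp.toLp 2 fun b' => WithLp.toLp 2 fun j' => if b' = b ∧ j' = j then (1 : ℝ) else 0

/-- The coordinate vector of the complexified slice (`B′ ∈ 𝔤ᶜ = ℂ³` per bond): `cplxSlice (basisR b j)`. [cite: Balaban1989LargeFieldI, Prop. 1
p.194 («B′ ∈ 𝔤ᶜ»)] -/
def basisC (b : ↥(freeBonds S T)) (j : Fin 3) : GaugeSlice S T (EuclideanSpace ℂ (Fin 3)) :=
  cplxSlice S T (basisR S T b j)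

/-- `basisR` coordinatewise. [cite: Balaban1989LargeFieldII, p.359] -/
@[simp] theorem basisR_apply (b b' : ↥(freeBonds S T)) (j j' : Fin 3) :
    basisR S T b j b' j' = if b' = b ∧ j' = j then (1 : ℝ) else 0 := rfl

/-- `basisC` coordinatewise. [cite: Balaban1989LargeFieldI, Prop. 1 p.194] -/
@[simp] theorem basisC_apply (b b' : ↥(freeBonds S T)) (j j' : Fin 3) :
    basisC S T b j b' j' = if b' = b ∧ j' = j then (1 : ℂ) else 0 := by
  rw [basisC, cplxSlice_apply, basisR_apply]
  split_ifs <;> simp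

/-- The `ℓ²` inner product of the slice in coordinates: `⟪u, v⟫ = Σ_b Σ_j u_{b,j} v_{b,j}`. [cite: Balaban1989LargeFieldII, (1.8)–(1.9) p.358] -/
theorem inner_eq_sum_real (u v : GaugeSlice S T E3) : ⟪u, v⟫_ℝ = ∑ b, ∑ j, u b j * v b j := by
  rw [PiLp.inner_apply]
  refine Finset.sum_congr rfl fun b _ => ?_
  rw [PiLp.inner_apply]
  refine Finset.sum_congr rfl fun j _ => ?_
  simp [mul_comm]

/-- Every real coordinate vector is the sum of its coordinates times the coordinate vectors. [folklore] -/
private theorem sum_repr_real (u : GaugeSlice S T E3) : ∑ b, ∑ j, u b j • basisR S T b j = u := by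
  ext b' j'
  simp only [WithLp.ofLp_sum, Finset.sum_apply, PiLp.smul_apply, smul_eq_mul, basisR_apply, mul_ite, mul_one, mul_zero]
  rw [Finset.sum_eq_single b' (fun b _ hb => by simp [Ne.symm hb]) (fun h => absurd (Finset.mem_univ _) h)]
  simp

/-- Every complex coordinate vector is the sum of its coordinates times the coordinate vectors. [folklore] -/
private theorem sum_repr_cplx (z : GaugeSlice S T (EuclideanSpace ℂ (Fin 3))) : ∑ b, ∑ j, z b j • basisC S T b j = z := by
  ext b' j'
  simp only [WithLp.ofLp_sum, Finset.sum_apply, PiLp.smul_apply, smul_eq_mul, basisC_apply, mul_ite, mul_one, mul_zero]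
  rw [Finset.sum_eq_single b' (fun b _ hb => by simp [Ne.symm hb]) (fun h => absurd (Finset.mem_univ _) h)]
  simp

/-- A real linear functional is the coordinate pairing with its values on the coordinate vectors. [folklore] -/
private theorem apply_eq_sum_real (ℓ : GaugeSlice S T E3 →L[ℝ] ℝ) (u : GaugeSlice S T E3) :
    ℓ u = ∑ b, ∑ j, u b j * ℓ (basisR S T b j) := by
  conv_lhs => rw [← sum_repr_real S T u]
  simp [map_sum, map_smul]

/-- A complex linear functional is the (bilinear) coordinate pairing with its values on the coordinate vectors. [folklore] -/
private theorem apply_eq_sum_cplx (ℓ : GaugeSlice S T (EuclideanSpace ℂ (Fin 3)) →L[ℂ] ℂ) (z : GaugeSlice S T (EuclideanSpace ℂ (Fin 3))) :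
    ℓ z = ∑ b, ∑ j, z b j * ℓ (basisC S T b j) := by
  conv_lhs => rw [← sum_repr_cplx S T z]
  simp [map_sum, map_smul]

end Coordinates

/-! ## §2 Coordinate Riesz maps and gradients -/

section Riesz

variable (S : Set (Site P k)) (T : Finset (PBond P k))

/-- The real coordinate Riesz map as a linear map (see `rieszR`). [cite: Balaban1989LargeFieldII, (1.12) p.359] -/
def rieszRₗ : (GaugeSlice S T E3 →L[ℝ] ℝ) →ₗ[ℝ] GaugeSlice S T E3 where
  toFun ℓ := WithLp.toLp 2 fun b => WithLp.toLp 2 fun j => ℓ (basisR S T b j)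
  map_add' ℓ ℓ' := by ext b j; simp
  map_smul' c ℓ := by ext b j; simp

/-- The REAL COORDINATE RIESZ MAP: a linear functional `ℓ` on the slice ↦ the vector `(ℓ(e_{b,j}))_{b,j}` — the vector representing `ℓ` in the
`ℓ²` inner product (`inner_rieszR`); a continuous linear map (finite dimension; the topological instances are supplied along their normed-space
paths). [cite: Balaban1989LargeFieldII, (1.12) p.359] -/
def rieszR : (GaugeSlice S T E3 →L[ℝ] ℝ) →L[ℝ] GaugeSlice S T E3 :=
  haveI : ContinuousSMul ℝ (GaugeSlice S T E3) := IsBoundedSMul.continuousSMul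
  haveI : T2Space (GaugeSlice S T E3 →L[ℝ] ℝ) := TopologicalSpace.t2Space_of_metrizableSpace
  LinearMap.toContinuousLinearMap (rieszRₗ S T)

/-- `rieszR ℓ` coordinatewise. [cite: Balaban1989LargeFieldII, (1.12) p.359] -/
@[simp] theorem rieszR_apply (ℓ : GaugeSlice S T E3 →L[ℝ] ℝ) (b : ↥(freeBonds S T)) (j : Fin 3) :
    rieszR S T ℓ b j = ℓ (basisR S T b j) := rfl

/-- The complex coordinate Riesz map as a linear map (see `rieszC`). [cite: Balaban1989LargeFieldII, p.359 («valid for 𝔤ᶜ-valued fields»)] -/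
def rieszCₗ : (GaugeSlice S T (EuclideanSpace ℂ (Fin 3)) →L[ℂ] ℂ) →ₗ[ℂ] GaugeSlice S T (EuclideanSpace ℂ (Fin 3)) where
  toFun ℓ := WithLp.toLp 2 fun b => WithLp.toLp 2 fun j => ℓ (basisC S T b j)
  map_add' ℓ ℓ' := by ext b j; simp
  map_smul' c ℓ := by ext b j; simp

/-- The COMPLEX COORDINATE RIESZ MAP (`ℂ`-LINEAR: the bilinear coordinate pairing, no conjugation): `ℓ ↦ (ℓ(e_{b,j}))_{b,j}`. [cite: Balaban1989LargeFieldII, p.359 («valid for 𝔤ᶜ-valued fields»)] -/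
def rieszC : (GaugeSlice S T (EuclideanSpace ℂ (Fin 3)) →L[ℂ] ℂ) →L[ℂ] GaugeSlice S T (EuclideanSpace ℂ (Fin 3)) :=
  haveI : ContinuousSMul ℂ (GaugeSlice S T (EuclideanSpace ℂ (Fin 3))) := IsBoundedSMul.continuousSMul
  haveI : T2Space (GaugeSlice S T (EuclideanSpace ℂ (Fin 3)) →L[ℂ] ℂ) := TopologicalSpace.t2Space_of_metrizableSpace
  LinearMap.toContinuousLinearMap (rieszCₗ S T)

/-- `rieszC ℓ` coordinatewise. [cite: Balaban1989LargeFieldII, p.359 («valid for 𝔤ᶜ-valued fields»)] -/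
@[simp] theorem rieszC_apply (ℓ : GaugeSlice S T (EuclideanSpace ℂ (Fin 3)) →L[ℂ] ℂ) (b : ↥(freeBonds S T)) (j : Fin 3) :
    rieszC S T ℓ b j = ℓ (basisC S T b j) := rfl

/-- **`rieszR ℓ` represents `ℓ`**: `⟪δ, rieszR ℓ⟫ = ℓ δ`. [cite: Balaban1989LargeFieldII, (1.12) p.359] -/
theorem inner_rieszR (ℓ : GaugeSlice S T E3 →L[ℝ] ℝ) (δ : GaugeSlice S T E3) : ⟪δ, rieszR S T ℓ⟫_ℝ = ℓ δ := by
  rw [inner_eq_sum_real, apply_eq_sum_real S T ℓ δ]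
  simp

/-- **`rieszC ℓ` represents `ℓ` in the BILINEAR coordinate pairing**: `ℓ z = Σ_{b,j} z_{b,j} (rieszC ℓ)_{b,j}`. [folklore] -/
private theorem apply_eq_sum_mul_rieszC (ℓ : GaugeSlice S T (EuclideanSpace ℂ (Fin 3)) →L[ℂ] ℂ) (z : GaugeSlice S T (EuclideanSpace ℂ (Fin 3))) :
    ℓ z = ∑ b, ∑ j, z b j * rieszC S T ℓ b j := by
  rw [apply_eq_sum_cplx S T ℓ z]
  simp

/-- The REAL COORDINATE GRADIENT of `g` at `X`: `rieszR (Dg(X))`, i.e. `(∂_{b,j} g(X))_{b,j}`. [cite: Balaban1989LargeFieldII, (1.12) p.359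
(«the condition for a critical configuration»)] -/
def rGrad (g : GaugeSlice S T E3 → ℝ) (X : GaugeSlice S T E3) : GaugeSlice S T E3 :=
  rieszR S T (fderiv ℝ g X)

/-- The COMPLEX COORDINATE GRADIENT of `G` at `Y`: `rieszC (DG(Y))`, i.e. `(∂_{b,j} G(Y))_{b,j}` (holomorphic partial derivatives).
[cite: Balaban1989LargeFieldII, p.359 («valid for 𝔤ᶜ-valued fields»)] -/
def cGrad (G : GaugeSlice S T (EuclideanSpace ℂ (Fin 3)) → ℂ) (Y : GaugeSlice S T (EuclideanSpace ℂ (Fin 3))) :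
    GaugeSlice S T (EuclideanSpace ℂ (Fin 3)) :=
  rieszC S T (fderiv ℂ G Y)

/-- `rGrad` unfolded. [cite: Balaban1989LargeFieldII, (1.12) p.359] -/
theorem rGrad_def (g : GaugeSlice S T E3 → ℝ) : rGrad S T g = fun X => rieszR S T (fderiv ℝ g X) := rfl

/-- `cGrad` unfolded. [cite: Balaban1989LargeFieldII, p.359 («valid for 𝔤ᶜ-valued fields»)] -/
theorem cGrad_def (G : GaugeSlice S T (EuclideanSpace ℂ (Fin 3)) → ℂ) : cGrad S T G = fun Y => rieszC S T (fderiv ℂ G Y) := rfl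

/-- `rGrad` coordinatewise: the partial derivative `Dg(X) e_{b,j}`. [cite: Balaban1989LargeFieldII, (1.12) p.359] -/
@[simp] theorem rGrad_apply (g : GaugeSlice S T E3 → ℝ) (X : GaugeSlice S T E3) (b : ↥(freeBonds S T)) (j : Fin 3) :
    rGrad S T g X b j = fderiv ℝ g X (basisR S T b j) := rfl

/-- `cGrad` coordinatewise: the partial derivative `DG(Y) e_{b,j}`. [cite: Balaban1989LargeFieldII, p.359 («valid for 𝔤ᶜ-valued fields»)] -/
@[simp] theorem cGrad_apply (G : GaugeSlice S T (EuclideanSpace ℂ (Fin 3)) → ℂ) (Y : GaugeSlice S T (EuclideanSpace ℂ (Fin 3)))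
    (b : ↥(freeBonds S T)) (j : Fin 3) : cGrad S T G Y b j = fderiv ℂ G Y (basisC S T b j) := rfl

/-- `⟪δ, rGrad g X⟫ = Dg(X) δ`. [cite: Balaban1989LargeFieldII, (1.12) p.359] -/
theorem inner_rGrad (g : GaugeSlice S T E3 → ℝ) (X δ : GaugeSlice S T E3) : ⟪δ, rGrad S T g X⟫_ℝ = fderiv ℝ g X δ :=
  inner_rieszR S T _ δ

/-- ★ **THE FIRST-VARIATION SHAPE (m5)**: if `g` is differentiable at `X`, then `s ↦ g(X + sδ)` has derivative `⟪δ, rGrad g X⟫` at `s = 0` — the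
left-hand side of print's (1.12) read as the derivative of the function *«expanded with respect to B′»*. [cite: Balaban1989LargeFieldII, (1.12) p.359] -/
theorem hasDerivAt_line_rGrad {g : GaugeSlice S T E3 → ℝ} {X : GaugeSlice S T E3} (hg : DifferentiableAt ℝ g X) (δ : GaugeSlice S T E3) :
    HasDerivAt (fun s : ℝ => g (X + s • δ)) ⟪δ, rGrad S T g X⟫_ℝ 0 := by
  -- the `ContinuousSMul` instance of the doubly-`PiLp` slice along its normed-space path (instance search for it is slow)
  haveI : ContinuousSMul ℝ (GaugeSlice S T E3) := IsBoundedSMul.continuousSMul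
  have hline : HasDerivAt (fun s : ℝ => X + s • δ) δ 0 := by
    simpa using ((hasDerivAt_id (0 : ℝ)).smul_const δ).const_add X
  have h := hg.hasFDerivAt.comp_hasDerivAt_of_eq (0 : ℝ) hline (by simp)
  rw [inner_rGrad]
  exact h

/-- The TAYLOR SPLIT of the gradient (trivial algebra): `⟪δ, ∇g(X)⟫ = ⟪δ, J⟫ + ⟪δ, Δ₁X⟫ + ⟪δ, ∇g(X) − J − Δ₁X⟫` for any `J`, `Δ₁` — the shape
`⟨δB′, H*J⟩ + ⟨δB′, H*Δ₁HB′⟩ + ⟨δB′, H*(δ/δA)V(HB′)⟩` of (1.12) at `H = id`. [cite: Balaban1989LargeFieldII, (1.11)–(1.12) p.359] -/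
theorem inner_rGrad_eq_taylor (g : GaugeSlice S T E3 → ℝ) (J : GaugeSlice S T E3) (Δ₁ : GaugeSlice S T E3 → GaugeSlice S T E3)
    (X δ : GaugeSlice S T E3) :
    ⟪δ, rGrad S T g X⟫_ℝ = ⟪δ, J⟫_ℝ + ⟪δ, Δ₁ X⟫_ℝ + ⟪δ, rGrad S T g X - J - Δ₁ X⟫_ℝ := by
  rw [← inner_add_right, ← inner_add_right]
  congr 1
  abel

/-- `‖z‖² = Σ_b Σ_j ‖z_{b,j}‖²` on the complexified slice. [folklore] -/
private theorem norm_sq_eq_sum_cplx (z : GaugeSlice S T (EuclideanSpace ℂ (Fin 3))) : ‖z‖ ^ 2 = ∑ b, ∑ j, ‖z b j‖ ^ 2 := by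
  rw [PiLp.norm_sq_eq_of_L2]
  refine Finset.sum_congr rfl fun b _ => ?_
  rw [PiLp.norm_sq_eq_of_L2]

/-- `‖cGrad G Y‖ ≤ ‖DG(Y)‖`: pair `DG(Y)` with the coordinatewise conjugate of `cGrad G Y` (same norm), whose bilinear pairing with `cGrad G Y` is
`‖cGrad G Y‖²`. [cite: Balaban1989LargeFieldII, p.359 («valid for 𝔤ᶜ-valued fields»)] -/
theorem norm_cGrad_le (G : GaugeSlice S T (EuclideanSpace ℂ (Fin 3)) → ℂ) (Y : GaugeSlice S T (EuclideanSpace ℂ (Fin 3))) :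
    ‖cGrad S T G Y‖ ≤ ‖fderiv ℂ G Y‖ := by
  set v := cGrad S T G Y with hv
  set u : GaugeSlice S T (EuclideanSpace ℂ (Fin 3)) :=
    WithLp.toLp 2 fun b => WithLp.toLp 2 fun j => (starRingEnd ℂ) (v b j) with hu
  have hnu : ‖u‖ = ‖v‖ := by
    have h2 : ‖u‖ ^ 2 = ‖v‖ ^ 2 := by
      rw [norm_sq_eq_sum_cplx, norm_sq_eq_sum_cplx]
      refine Finset.sum_congr rfl fun b _ => Finset.sum_congr rfl fun j _ => ?_
      simp [hu]
    exact (pow_left_inj₀ (norm_nonneg _) (norm_nonneg _) two_ne_zero).1 h2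
  have hpair : fderiv ℂ G Y u = ((‖v‖ ^ 2 : ℝ) : ℂ) := by
    rw [apply_eq_sum_mul_rieszC S T (fderiv ℂ G Y) u, norm_sq_eq_sum_cplx]
    push_cast
    refine Finset.sum_congr rfl fun b _ => Finset.sum_congr rfl fun j _ => ?_
    have e1 : rieszC S T (fderiv ℂ G Y) b j = v b j := rfl
    rw [e1]
    simp only [hu]
    rw [RCLike.conj_mul]
    norm_cast
  have hle : ‖v‖ ^ 2 ≤ ‖fderiv ℂ G Y‖ * ‖v‖ := by
    have h := (fderiv ℂ G Y).le_opNorm u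
    rw [hpair, hnu] at h
    have e : ‖((‖v‖ ^ 2 : ℝ) : ℂ)‖ = ‖v‖ ^ 2 := by
      rw [Complex.norm_real, Real.norm_eq_abs, abs_of_nonneg (sq_nonneg _)]
    rwa [e] at h
  by_cases h0 : ‖v‖ = 0
  · rw [h0]; exact norm_nonneg _
  · have hpos : 0 < ‖v‖ := lt_of_le_of_ne (norm_nonneg _) (Ne.symm h0)
    rw [pow_two] at hle
    exact le_of_mul_le_mul_right hle hpos

end Riesz

/-! ## §3 Real points of a holomorphic extension -/

section RealPoints

variable (S : Set (Site P k)) (T : Finset (PBond P k))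

/-- `cplxSlice` as a CONTINUOUS real-linear map (norm-preserving: `norm_cplxSlice`). [cite: Balaban1989LargeFieldI, Prop. 1 p.194] -/
def cplxSliceL : GaugeSlice S T E3 →L[ℝ] GaugeSlice S T (EuclideanSpace ℂ (Fin 3)) :=
  (cplxSlice S T).mkContinuous 1 fun B => by rw [norm_cplxSlice, one_mul]

/-- `cplxSliceL` is `cplxSlice`. [cite: Balaban1989LargeFieldI, Prop. 1 p.194] -/
@[simp] theorem cplxSliceL_apply (B : GaugeSlice S T E3) : cplxSliceL S T B = cplxSlice S T B := rfl

/-- The real part as a continuous real-linear functional on `ℂ` composed on the left: `g = re ∘ G ∘ ι` near a real point where `G ∘ ι = g`.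
A real function with a complex-differentiable extension near `ι X` is real-differentiable at `X`. [cite: Balaban1989LargeFieldII, p.359 («valid for 𝔤ᶜ-valued fields»)] -/
theorem differentiableAt_of_cplx {g : GaugeSlice S T E3 → ℝ} {G : GaugeSlice S T (EuclideanSpace ℂ (Fin 3)) → ℂ} {X : GaugeSlice S T E3}
    (hG : DifferentiableAt ℂ G (cplxSlice S T X)) (hagree : ∀ᶠ X' in 𝓝 X, G (cplxSlice S T X') = (g X' : ℂ)) :
    DifferentiableAt ℝ g X := by
  have h1 : DifferentiableAt ℝ (fun X' => Complex.reCLM (G (cplxSliceL S T X'))) X := by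
    refine Complex.reCLM.differentiableAt.comp X ?_
    exact (hG.restrictScalars ℝ).comp X (cplxSliceL S T).differentiableAt
  refine h1.congr_of_eventuallyEq ?_
  filter_upwards [hagree] with X' hX'
  simp only [cplxSliceL_apply, hX', Complex.reCLM_apply, Complex.ofReal_re]

/-- **REAL DIRECTIONAL DERIVATIVES OF THE EXTENSION ARE THE REAL DERIVATIVES**: `DG(ιX)(ιu) = Dg(X)u` whenever `G` is complex-differentiable at
`ιX` and `G ∘ ι = g` near `X` (differentiate `t ↦ G(ι(X + tu)) = g(X + tu)` at `t = 0` in two ways). [cite: Balaban1989LargeFieldII, p.359 («valid for 𝔤ᶜ-valued fields»)] -/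
theorem fderiv_cplxSlice_apply {g : GaugeSlice S T E3 → ℝ} {G : GaugeSlice S T (EuclideanSpace ℂ (Fin 3)) → ℂ} {X : GaugeSlice S T E3}
    (hG : DifferentiableAt ℂ G (cplxSlice S T X)) (hagree : ∀ᶠ X' in 𝓝 X, G (cplxSlice S T X') = (g X' : ℂ)) (u : GaugeSlice S T E3) :
    fderiv ℂ G (cplxSlice S T X) (cplxSlice S T u) = ((fderiv ℝ g X u : ℝ) : ℂ) := by
  haveI : ContinuousSMul ℝ (GaugeSlice S T E3) := IsBoundedSMul.continuousSMul
  have hline : HasDerivAt (fun t : ℝ => X + t • u) u 0 := by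
    simpa using ((hasDerivAt_id (0 : ℝ)).smul_const u).const_add X
  -- (A) along the complex side: `t ↦ G (ι (X + t u))`
  have hlineC : HasDerivAt (fun t : ℝ => cplxSliceL S T (X + t • u)) (cplxSliceL S T u) 0 :=
    (cplxSliceL S T).hasFDerivAt.comp_hasDerivAt_of_eq (0 : ℝ) hline rfl
  have hA : HasDerivAt (fun t : ℝ => G (cplxSlice S T (X + t • u))) (fderiv ℂ G (cplxSlice S T X) (cplxSlice S T u)) 0 := by
    have h := (hG.hasFDerivAt.restrictScalars ℝ).comp_hasDerivAt_of_eq (0 : ℝ) hlineC (by simp)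
    exact h.congr_deriv (by simp)
  -- (B) along the real side: `t ↦ g (X + t u)`, cast to `ℂ`
  have hg : DifferentiableAt ℝ g X := differentiableAt_of_cplx S T hG hagree
  have hB0 : HasDerivAt (fun t : ℝ => g (X + t • u)) (fderiv ℝ g X u) 0 :=
    hg.hasFDerivAt.comp_hasDerivAt_of_eq (0 : ℝ) hline (by simp)
  have hB : HasDerivAt (fun t : ℝ => ((g (X + t • u) : ℝ) : ℂ)) ((fderiv ℝ g X u : ℝ) : ℂ) 0 := hB0.ofReal_comp
  -- the two functions agree near `t = 0`
  have htend : Tendsto (fun t : ℝ => X + t • u) (𝓝 0) (𝓝 X) := by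
    have h := hline.continuousAt.tendsto
    simpa using h
  have heq : (fun t : ℝ => G (cplxSlice S T (X + t • u))) =ᶠ[𝓝 0] fun t => ((g (X + t • u) : ℝ) : ℂ) :=
    htend.eventually hagree
  exact hA.unique (hB.congr_of_eventuallyEq heq)

/-- ★ **THE COMPLEX GRADIENT AT A REAL POINT IS THE REAL GRADIENT**: `cGrad G (ιX) = ι(rGrad g X)`. [cite: Balaban1989LargeFieldII, p.359 («valid for 𝔤ᶜ-valued fields»)] -/
theorem cGrad_cplxSlice {g : GaugeSlice S T E3 → ℝ} {G : GaugeSlice S T (EuclideanSpace ℂ (Fin 3)) → ℂ} {X : GaugeSlice S T E3}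
    (hG : DifferentiableAt ℂ G (cplxSlice S T X)) (hagree : ∀ᶠ X' in 𝓝 X, G (cplxSlice S T X') = (g X' : ℂ)) :
    cGrad S T G (cplxSlice S T X) = cplxSlice S T (rGrad S T g X) := by
  ext b j
  rw [cGrad_apply, cplxSlice_apply, rGrad_apply, basisC]
  exact fderiv_cplxSlice_apply S T hG hagree (basisR S T b j)

/-- On the open ball `‖X‖ < R` the agreement `G ∘ ι = g` holds near every point (bookkeeping). [folklore] -/
private theorem eventually_agree_of_ball {g : GaugeSlice S T E3 → ℝ} {G : GaugeSlice S T (EuclideanSpace ℂ (Fin 3)) → ℂ} {R : ℝ}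
    (hagree : ∀ X : GaugeSlice S T E3, ‖X‖ < R → G (cplxSlice S T X) = (g X : ℂ)) {X : GaugeSlice S T E3} (hX : ‖X‖ < R) :
    ∀ᶠ X' in 𝓝 X, G (cplxSlice S T X') = (g X' : ℂ) := by
  have hopen : IsOpen {X' : GaugeSlice S T E3 | ‖X'‖ < R} := isOpen_lt continuous_norm continuous_const
  exact Filter.eventually_of_mem (hopen.mem_nhds hX) fun X' hX' => hagree X' hX'

/-- A point of the real ball maps into the complex ball (`‖ιX‖ = ‖X‖`). [folklore] -/
private theorem cplxSlice_mem_ball {R : ℝ} {X : GaugeSlice S T E3} (hX : ‖X‖ < R) :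
    cplxSlice S T X ∈ ball (0 : GaugeSlice S T (EuclideanSpace ℂ (Fin 3))) R := by
  rw [mem_ball_zero_iff, norm_cplxSlice]
  exact hX

/-- A REAL FUNCTION WITH A HOLOMORPHIC EXTENSION ON A BALL IS `C²` THERE (indeed `C^∞`; `g = re ∘ G ∘ ι`), hence its coordinate gradient is
differentiable. [cite: Balaban1989LargeFieldII, p.359 («valid for 𝔤ᶜ-valued fields»)] -/
theorem differentiableAt_rGrad_of_cplx {g : GaugeSlice S T E3 → ℝ} {G : GaugeSlice S T (EuclideanSpace ℂ (Fin 3)) → ℂ} {R : ℝ}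
    (hGd : DifferentiableOn ℂ G (ball 0 R)) (hagree : ∀ X : GaugeSlice S T E3, ‖X‖ < R → G (cplxSlice S T X) = (g X : ℂ))
    {X : GaugeSlice S T E3} (hX : ‖X‖ < R) : DifferentiableAt ℝ (rGrad S T g) X := by
  haveI : ContinuousSMul ℝ (GaugeSlice S T E3) := IsBoundedSMul.continuousSMul
  have hGa : AnalyticAt ℂ G (cplxSlice S T X) :=
    Literature.Analysis.Complex.SCV.analyticAt_of_differentiableOn hGd isOpen_ball (cplxSlice_mem_ball S T hX)
  have h2 : ContDiffAt ℝ 2 (fun X' => Complex.reCLM (G (cplxSliceL S T X'))) X := by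
    refine Complex.reCLM.contDiff.contDiffAt.comp X ?_
    exact ((hGa.contDiffAt (n := 2)).restrict_scalars ℝ).comp X (cplxSliceL S T).contDiff.contDiffAt
  have hg2 : ContDiffAt ℝ 2 g X := by
    refine h2.congr_of_eventuallyEq ?_
    filter_upwards [eventually_agree_of_ball S T hagree hX] with X' hX'
    simp only [cplxSliceL_apply, hX', Complex.reCLM_apply, Complex.ofReal_re]
  have hD : DifferentiableAt ℝ (fderiv ℝ g) X :=
    (hg2.fderiv_right (m := 1) (by norm_num)).differentiableAt (by norm_num)
  rw [rGrad_def]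
  exact (rieszR S T).differentiableAt.comp X hD

/-- The complex coordinate gradient of a map complex-differentiable on an open set is complex-differentiable there (Osgood: holomorphic ⇒
analytic ⇒ the derivative is analytic; `cGrad = rieszC ∘ DG`). [cite: Balaban1989LargeFieldII, p.359 («valid for 𝔤ᶜ-valued fields»)] -/
theorem differentiableOn_cGrad {G : GaugeSlice S T (EuclideanSpace ℂ (Fin 3)) → ℂ} {U : Set (GaugeSlice S T (EuclideanSpace ℂ (Fin 3)))}
    (hU : IsOpen U) (hGd : DifferentiableOn ℂ G U) : DifferentiableOn ℂ (cGrad S T G) U := by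
  have hA : AnalyticOnNhd ℂ G U := Literature.Analysis.Complex.SCV.analyticOnNhd_of_differentiableOn hGd hU
  rw [cGrad_def]
  exact (rieszC S T).differentiable.comp_differentiableOn hA.fderiv.differentiableOn

/-- ★ **SECOND ORDER AT REAL POINTS**: if `G` is complex-differentiable on the ball `‖Y‖ < R` and `G ∘ ι = g` on the real ball, then
`D(cGrad G)(0)(ιu) = ι(D(rGrad g)(0) u)` — the complex Hessian restricts to the real one (differentiate the identity `cGrad G ∘ ι = ι ∘ rGrad g`,
valid on the real ball by `cGrad_cplxSlice`, at `0`). [cite: Balaban1989LargeFieldII, p.359 («valid for 𝔤ᶜ-valued fields»)] -/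
theorem fderiv_cGrad_cplxSlice {g : GaugeSlice S T E3 → ℝ} {G : GaugeSlice S T (EuclideanSpace ℂ (Fin 3)) → ℂ} {R : ℝ} (hR : 0 < R)
    (hGd : DifferentiableOn ℂ G (ball 0 R)) (hagree : ∀ X : GaugeSlice S T E3, ‖X‖ < R → G (cplxSlice S T X) = (g X : ℂ))
    (u : GaugeSlice S T E3) :
    fderiv ℂ (cGrad S T G) 0 (cplxSlice S T u) = cplxSlice S T (fderiv ℝ (rGrad S T g) 0 u) := by
  haveI : ContinuousSMul ℝ (GaugeSlice S T E3) := IsBoundedSMul.continuousSMul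
  haveI : ContinuousSMul ℝ (GaugeSlice S T (EuclideanSpace ℂ (Fin 3))) := IsBoundedSMul.continuousSMul
  -- the two composites agree near `0`
  have hpt : ∀ X : GaugeSlice S T E3, ‖X‖ < R → cGrad S T G (cplxSlice S T X) = cplxSlice S T (rGrad S T g X) := fun X hX =>
    cGrad_cplxSlice S T (hGd.differentiableAt (isOpen_ball.mem_nhds (cplxSlice_mem_ball S T hX))) (eventually_agree_of_ball S T hagree hX)
  have h0 : ‖(0 : GaugeSlice S T E3)‖ < R := by rwa [norm_zero]
  have heq : (fun X => cGrad S T G (cplxSliceL S T X)) =ᶠ[𝓝 0] fun X => cplxSliceL S T (rGrad S T g X) := by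
    filter_upwards [(isOpen_lt continuous_norm continuous_const).mem_nhds h0] with X hX
    simp only [cplxSliceL_apply]
    exact hpt X hX
  -- derivative of the left composite
  have hΦ : DifferentiableAt ℂ (cGrad S T G) (cplxSliceL S T 0) := by
    rw [cplxSliceL_apply, map_zero]
    exact (differentiableOn_cGrad S T isOpen_ball hGd).differentiableAt (isOpen_ball.mem_nhds (mem_ball_self hR))
  have hL : HasFDerivAt (fun X => cGrad S T G (cplxSliceL S T X))
      (((fderiv ℂ (cGrad S T G) (cplxSliceL S T 0)).restrictScalars ℝ).comp (cplxSliceL S T)) 0 :=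
    (hΦ.hasFDerivAt.restrictScalars ℝ).comp 0 (cplxSliceL S T).hasFDerivAt
  -- derivative of the right composite
  have hφ : DifferentiableAt ℝ (rGrad S T g) 0 := differentiableAt_rGrad_of_cplx S T hGd hagree h0
  have hRt : HasFDerivAt (fun X => cplxSliceL S T (rGrad S T g X)) ((cplxSliceL S T).comp (fderiv ℝ (rGrad S T g) 0)) 0 :=
    (cplxSliceL S T).hasFDerivAt.comp 0 hφ.hasFDerivAt
  have huniq := hL.unique (hRt.congr_of_eventuallyEq heq)
  have h := congrArg (fun L : GaugeSlice S T E3 →L[ℝ] GaugeSlice S T (EuclideanSpace ℂ (Fin 3)) => L u) huniq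
  simp only [ContinuousLinearMap.comp_apply, ContinuousLinearMap.coe_restrictScalars', cplxSliceL_apply, map_zero] at h
  exact h

end RealPoints

/-! ## §4 The Proposition-4 shape from Cauchy's estimates -/

section Prop4

variable (S : Set (Site P k)) (T : Finset (PBond P k))

/-- ★★ **THE PROPOSITION-4 SHAPE OF THE COMPLEX TAYLOR REMAINDER FROM CAUCHY's ESTIMATES.**  If `G` is complex-differentiable on the ball
`‖Y‖ < R` of the complexified slice and bounded by `𝓐` there, then the second-order Taylor remainder of its coordinate gradient,
`W(Y) = cGrad G Y − cGrad G 0 − D(cGrad G)(0) Y`, satisfies r08's typed hypothesis of [15] Proposition 4: `‖W(Y)‖ ≤ (64𝓐/R³)‖Y‖²` and `W`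
complex-differentiable for `‖Y‖ < R/2`.  Cauchy (`‖DG(Y)‖ ≤ 2𝓐/(R/2)` on the half ball, the tree's `norm_fderiv_le_of_forall_mem_ball_norm_le`)
bounds `‖cGrad G‖ ≤ 4𝓐/R` there (`norm_cGrad_le`), and the second-order Schwarz estimate (the tree's `norm_sub_sub_fderiv_le_of_forall_mem_ball_norm_le`,
Mathlib's `Complex.dist_le_mul_div_pow_of_mapsTo_ball_of_isLittleO`) gives `‖W(Y)‖ ≤ 4·(4𝓐/R)·(‖Y‖/(R/2))²`.
[cite: Balaban1985Variational, Prop. 4 (97)–(98) pp.292–293; Balaban1989LargeFieldII, p.359 («Using Proposition 4 [15]»)] -/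
theorem prop4Hyp_taylorRemainder {G : GaugeSlice S T (EuclideanSpace ℂ (Fin 3)) → ℂ} {R 𝓐 : ℝ} (hR : 0 < R)
    (hGd : DifferentiableOn ℂ G (ball 0 R)) (hGb : ∀ Y ∈ ball (0 : GaugeSlice S T (EuclideanSpace ℂ (Fin 3))) R, ‖G Y‖ ≤ 𝓐) :
    Prop4Hyp (fun Y => cGrad S T G Y - cGrad S T G 0 - fderiv ℂ (cGrad S T G) 0 Y) (64 * 𝓐 / R ^ 3) (R / 2) := by
  have hR2 : 0 < R / 2 := by linarith
  have hΦd : DifferentiableOn ℂ (cGrad S T G) (ball 0 R) := differentiableOn_cGrad S T isOpen_ball hGd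
  have hsub : ball (0 : GaugeSlice S T (EuclideanSpace ℂ (Fin 3))) (R / 2) ⊆ ball 0 R := ball_subset_ball (by linarith)
  -- Cauchy on the half ball: ‖cGrad G Y‖ ≤ 4𝓐/R
  have hB : ∀ Y ∈ ball (0 : GaugeSlice S T (EuclideanSpace ℂ (Fin 3))) (R / 2), ‖cGrad S T G Y‖ ≤ 4 * 𝓐 / R := by
    intro Y hY
    have hYsub : ball Y (R / 2) ⊆ ball 0 R := by
      intro Y' hY'
      rw [mem_ball_zero_iff]
      rw [mem_ball] at hY'
      rw [mem_ball_zero_iff] at hY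
      calc ‖Y'‖ = ‖(Y' - Y) + Y‖ := by rw [sub_add_cancel]
        _ ≤ ‖Y' - Y‖ + ‖Y‖ := norm_add_le _ _
        _ < R / 2 + R / 2 := add_lt_add (by rwa [← dist_eq_norm]) hY
        _ = R := by ring
    have hc := norm_fderiv_le_of_forall_mem_ball_norm_le hR2 (hGd.mono hYsub) fun w hw => hGb w (hYsub hw)
    calc ‖cGrad S T G Y‖ ≤ ‖fderiv ℂ G Y‖ := norm_cGrad_le S T G Y
      _ ≤ 2 * 𝓐 / (R / 2) := hc
      _ = 4 * 𝓐 / R := by field_simp; ring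
  have hball_eq : {Y : GaugeSlice S T (EuclideanSpace ℂ (Fin 3)) | ‖Y‖ < R / 2} = ball 0 (R / 2) := by
    ext Y; simp
  refine ⟨fun Y hY => ?_, ?_⟩
  · have hYm : Y ∈ ball (0 : GaugeSlice S T (EuclideanSpace ℂ (Fin 3))) (R / 2) := by rwa [mem_ball_zero_iff]
    have h := norm_sub_sub_fderiv_le_of_forall_mem_ball_norm_le (hΦd.mono hsub) hB hYm
    rw [sub_zero] at h
    calc ‖cGrad S T G Y - cGrad S T G 0 - fderiv ℂ (cGrad S T G) 0 Y‖ ≤ 4 * (4 * 𝓐 / R) * (‖Y‖ / (R / 2)) ^ 2 := h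
      _ = 64 * 𝓐 / R ^ 3 * ‖Y‖ ^ 2 := by field_simp; ring
  · rw [hball_eq]
    exact ((hΦd.mono hsub).sub_const _).sub ((fderiv ℂ (cGrad S T G) 0).differentiable.differentiableOn)

end Prop4

/-! ## §5 From bond fields to the slice -/

section Bonds

variable (S : Set (Site P k)) (T : Finset (PBond P k))

/-- The `ℂ`-linear EXTENSION BY ZERO of complexified coordinates to `𝔤ᶜ`-valued bond fields (the complex twin of `ιA`), as a linear map.
[cite: Balaban1989LargeFieldI, Prop. 1 p.194 («B′ ∈ 𝔤ᶜ»)] -/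
def ιAcₗ : GaugeSlice S T (EuclideanSpace ℂ (Fin 3)) →ₗ[ℂ] VecField P k (EuclideanSpace ℂ (Fin 3)) where
  toFun Y b := if h : b ∈ freeBonds S T then Y ⟨b, h⟩ else 0
  map_add' Y Y' := by
    funext b
    by_cases h : b ∈ freeBonds S T
    · simp only [dif_pos h, Pi.add_apply, PiLp.add_apply]
    · simp only [dif_neg h, Pi.add_apply, add_zero]
  map_smul' c Y := by
    funext b
    by_cases h : b ∈ freeBonds S T
    · simp only [dif_pos h, Pi.smul_apply, PiLp.smul_apply, RingHom.id_apply]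
    · simp only [dif_neg h, Pi.smul_apply, smul_zero, RingHom.id_apply]

/-- Each bond value of `ιAcₗ Y` is dominated by `‖Y‖`. [folklore] -/
private theorem norm_ιAcₗ_apply_le (Y : GaugeSlice S T (EuclideanSpace ℂ (Fin 3))) (b : PBond P k) : ‖ιAcₗ S T Y b‖ ≤ ‖Y‖ := by
  show ‖(if h : b ∈ freeBonds S T then Y ⟨b, h⟩ else 0)‖ ≤ ‖Y‖
  by_cases h : b ∈ freeBonds S T
  · rw [dif_pos h]; exact PiLp.norm_apply_le Y ⟨b, h⟩
  · rw [dif_neg h, norm_zero]; exact norm_nonneg _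

/-- `ιAc : GaugeSlice S T ℂ³ →L[ℂ] (bonds → ℂ³)`, the continuous `ℂ`-linear extension by zero (`‖ιAc Y‖ ≤ ‖Y‖`). [cite: Balaban1989LargeFieldI,
Prop. 1 p.194] -/
def ιAc : GaugeSlice S T (EuclideanSpace ℂ (Fin 3)) →L[ℂ] VecField P k (EuclideanSpace ℂ (Fin 3)) :=
  (ιAcₗ S T).mkContinuous 1 fun Y => by
    rw [one_mul]
    exact (pi_norm_le_iff_of_nonneg (norm_nonneg Y)).2 (norm_ιAcₗ_apply_le S T Y)

/-- `ιAc Y` on a free bond is the coordinate. [cite: Balaban1989LargeFieldI, Prop. 1 p.194] -/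
theorem ιAc_apply_of_mem (Y : GaugeSlice S T (EuclideanSpace ℂ (Fin 3))) {b : PBond P k} (h : b ∈ freeBonds S T) :
    ιAc S T Y b = Y ⟨b, h⟩ := by
  show (if h : b ∈ freeBonds S T then Y ⟨b, h⟩ else 0) = Y ⟨b, h⟩
  rw [dif_pos h]

/-- `ιAc Y = 0` off the free bonds. [cite: Balaban1989LargeFieldI, Prop. 1 p.194] -/
theorem ιAc_apply_of_not_mem (Y : GaugeSlice S T (EuclideanSpace ℂ (Fin 3))) {b : PBond P k} (h : b ∉ freeBonds S T) :
    ιAc S T Y b = 0 := by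
  show (if h : b ∈ freeBonds S T then Y ⟨b, h⟩ else 0) = 0
  rw [dif_neg h]

/-- `‖ιAc Y‖ ≤ ‖Y‖` (sup norm over bonds vs `ℓ²` norm). [cite: Balaban1989LargeFieldI, Prop. 1 p.194] -/
theorem norm_ιAc_le (Y : GaugeSlice S T (EuclideanSpace ℂ (Fin 3))) : ‖ιAc S T Y‖ ≤ ‖Y‖ :=
  (pi_norm_le_iff_of_nonneg (norm_nonneg Y)).2 (norm_ιAcₗ_apply_le S T Y)

/-- **The complex extension by zero restricts to the real one**: `ιAc (ι B) = cplxVec (ιA B)`. [cite: Balaban1989LargeFieldI, Prop. 1 p.194] -/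
theorem ιAc_cplxSlice (B : GaugeSlice S T E3) : ιAc S T (cplxSlice S T B) = cplxVec (ιA S T B) := by
  funext b
  by_cases h : b ∈ freeBonds S T
  · rw [ιAc_apply_of_mem S T _ h]
    ext i
    simp [cplxVec, ιA_apply_of_mem B h]
  · rw [ιAc_apply_of_not_mem S T _ h]
    ext i
    simp [cplxVec, ιA_apply_of_not_mem B h]

/-- `‖ιA B‖ ≤ ‖B‖` (sup norm of the extension by zero vs `ℓ²` norm of the coordinates). [cite: Balaban1989LargeFieldII, (1.12) p.359] -/
theorem norm_ιA_le (B : GaugeSlice S T E3) : ‖ιA S T B‖ ≤ ‖B‖ :=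
  (pi_norm_le_iff_of_nonneg (norm_nonneg B)).2 fun b => norm_ιA_apply_le B b

omit [DecidableEq (PBond P k)] in
/-- `cplxVec` is real-linear (a linear map). [cite: Balaban1989LargeFieldI, Prop. 1 p.194] -/
def cplxVecₗ : VecField P k E3 →ₗ[ℝ] VecField P k (EuclideanSpace ℂ (Fin 3)) where
  toFun := cplxVec
  map_add' p q := by funext b; ext i; simp [cplxVec]
  map_smul' c p := by funext b; ext i; simp [cplxVec]

omit [DecidableEq (PBond P k)] in
/-- `cplxVec` as a CONTINUOUS real-linear map (`‖cplxVec p‖ = ‖p‖`). [cite: Balaban1989LargeFieldI, Prop. 1 p.194] -/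
def cplxVecL : VecField P k E3 →L[ℝ] VecField P k (EuclideanSpace ℂ (Fin 3)) :=
  (cplxVecₗ (P := P) (k := k)).mkContinuous 1 fun p => by
    show ‖cplxVec p‖ ≤ 1 * ‖p‖
    rw [norm_cplxVec, one_mul]

omit [DecidableEq (PBond P k)] in
/-- `cplxVecL` is `cplxVec`. [cite: Balaban1989LargeFieldI, Prop. 1 p.194] -/
@[simp] theorem cplxVecL_apply (p : VecField P k E3) : cplxVecL p = cplxVec p := rfl

/-- The real part of a complexified real coordinate vector is the vector: `reSlice (ι u) = u`. [cite: Balaban1989LargeFieldI, Prop. 1 p.194] -/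
@[simp] theorem reSlice_cplxSlice (u : GaugeSlice S T E3) : reSlice S T (cplxSlice S T u) = u := by
  ext b j
  simp [reSlice, cplxSlice_apply]

/-- **PRINT'S FUNCTION IN THE GAUGE-FIXED COORDINATES**: `sliceFn S T f V (B) = f(exp(i·ιA B)·V)` — for `f = A(U_{k,Z}(·))` and `V = Ṽ_k` (the
extended datum) this is *«the function V′↾_Λ → A(U_{k,Z}(V′Ṽ_k)) … V′ = exp iB′»* restricted to the coordinates `B′` satisfying the gauge
condition. [cite: Balaban1989LargeFieldII, p.359] -/
def sliceFn (f : GaugeField P k SU2 → ℝ) (V : GaugeField P k SU2) : GaugeSlice S T E3 → ℝ :=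
  fun B => f (expMul su2Chart (ιA S T B) V)

/-- `sliceFn` unfolded. [cite: Balaban1989LargeFieldII, p.359] -/
theorem sliceFn_apply (f : GaugeField P k SU2 → ℝ) (V : GaugeField P k SU2) (B : GaugeSlice S T E3) :
    sliceFn S T f V B = f (expMul su2Chart (ιA S T B) V) := rfl

/-- ★★ **THE SLICE PACKAGE FROM ONE HOLOMORPHIC EXTENSION ON BOND FIELDS.**  Let `F(B′) = f(exp(iB′)·V)` on real bond fields, and let `G` be
complex-differentiable on the sup-ball `‖B′‖ < R` of `𝔤ᶜ`-valued bond fields, bounded by `𝓐` there, with `G(cplxVec B′) = F(B′)` for real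
`‖B′‖ < R` ([15] Thm 1 ∕ [LF-II] p. 359 *«valid for 𝔤ᶜ-valued fields»*).  Put `g = sliceFn S T f V`, `Gs = G ∘ ιAc`, `J = rGrad g 0`,
`Δ₁ = D(rGrad g)(0)`, `dV(X) = rGrad g X − J − Δ₁X`, `W(Y) = cGrad Gs Y − cGrad Gs 0 − D(cGrad Gs)(0)Y`.  Then:
(a) `F` is real-differentiable at every chart point `ιA B`, `‖B‖ < R` (the chain's `hG`);
(b) for `‖X‖ < R` and every `δ`: `d/ds g(X + sδ)|₀ = ⟪δ, J⟫ + ⟪δ, Δ₁X⟫ + ⟪δ, dV X⟫` (the chain's `hA` at `H = id`);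
(c) `Prop4Hyp W (64𝓐/R³) (R/2)` (the chain's `hW`);
(d) `W(ι u) = ι(dV u)` for `‖u‖ < R` (the chain's `hWdV` on the ball).
[cite: Balaban1989LargeFieldII, (1.11)–(1.12) p.359; Balaban1985Variational, Prop. 4 pp.292–293; Balaban1989LargeFieldI, Prop. 1 p.194] -/
theorem slice_package_of_holomorphic (f : GaugeField P k SU2 → ℝ) (V : GaugeField P k SU2) {R 𝓐 : ℝ} (hR : 0 < R)
    (G : VecField P k (EuclideanSpace ℂ (Fin 3)) → ℂ) (hGd : DifferentiableOn ℂ G (ball 0 R))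
    (hGb : ∀ Y ∈ ball (0 : VecField P k (EuclideanSpace ℂ (Fin 3))) R, ‖G Y‖ ≤ 𝓐)
    (hGr : ∀ B' : VecField P k E3, ‖B'‖ < R → G (cplxVec B') = ((f (expMul su2Chart B' V) : ℝ) : ℂ)) :
    (∀ B : GaugeSlice S T E3, ‖B‖ < R →
        DifferentiableAt ℝ (fun B' : VecField P k E3 => f (expMul su2Chart B' V)) (ιA S T B)) ∧
      (∀ X δ : GaugeSlice S T E3, ‖X‖ < R →
        HasDerivAt (fun s : ℝ => sliceFn S T f V (X + s • δ))
          (⟪δ, rGrad S T (sliceFn S T f V) 0⟫_ℝ + ⟪δ, (fderiv ℝ (rGrad S T (sliceFn S T f V)) 0) X⟫_ℝ +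
            ⟪δ, rGrad S T (sliceFn S T f V) X - rGrad S T (sliceFn S T f V) 0 - (fderiv ℝ (rGrad S T (sliceFn S T f V)) 0) X⟫_ℝ) 0) ∧
      Prop4Hyp (fun Y => cGrad S T (fun Y' => G (ιAc S T Y')) Y - cGrad S T (fun Y' => G (ιAc S T Y')) 0 -
          fderiv ℂ (cGrad S T (fun Y' => G (ιAc S T Y'))) 0 Y) (64 * 𝓐 / R ^ 3) (R / 2) ∧
      (∀ u : GaugeSlice S T E3, ‖u‖ < R →
        cGrad S T (fun Y' => G (ιAc S T Y')) (cplxSlice S T u) - cGrad S T (fun Y' => G (ιAc S T Y')) 0 -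
            fderiv ℂ (cGrad S T (fun Y' => G (ιAc S T Y'))) 0 (cplxSlice S T u) =
          cplxSlice S T (rGrad S T (sliceFn S T f V) u - rGrad S T (sliceFn S T f V) 0 -
            (fderiv ℝ (rGrad S T (sliceFn S T f V)) 0) u)) := by
  -- the complex slice function and its three properties
  set Gs : GaugeSlice S T (EuclideanSpace ℂ (Fin 3)) → ℂ := fun Y' => G (ιAc S T Y') with hGs
  have hmaps : MapsTo (ιAc S T) (ball (0 : GaugeSlice S T (EuclideanSpace ℂ (Fin 3))) R) (ball 0 R) := by
    intro Y hY
    rw [mem_ball_zero_iff] at hY ⊢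
    exact (norm_ιAc_le S T Y).trans_lt hY
  have hGsd : DifferentiableOn ℂ Gs (ball 0 R) := hGd.comp (ιAc S T).differentiable.differentiableOn hmaps
  have hGsb : ∀ Y ∈ ball (0 : GaugeSlice S T (EuclideanSpace ℂ (Fin 3))) R, ‖Gs Y‖ ≤ 𝓐 := fun Y hY => hGb _ (hmaps hY)
  have hGsr : ∀ X : GaugeSlice S T E3, ‖X‖ < R → Gs (cplxSlice S T X) = ((sliceFn S T f V X : ℝ) : ℂ) := by
    intro X hX
    simp only [hGs, ιAc_cplxSlice, sliceFn_apply]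
    exact hGr _ ((norm_ιA_le S T X).trans_lt hX)
  -- (a) real differentiability on the full bond-field space at the chart points
  have ha : ∀ B : GaugeSlice S T E3, ‖B‖ < R →
      DifferentiableAt ℝ (fun B' : VecField P k E3 => f (expMul su2Chart B' V)) (ιA S T B) := by
    intro B hB
    have hBR : ‖ιA S T B‖ < R := (norm_ιA_le S T B).trans_lt hB
    have hmem : cplxVec (ιA S T B) ∈ ball (0 : VecField P k (EuclideanSpace ℂ (Fin 3))) R := by
      rw [mem_ball_zero_iff, norm_cplxVec]; exact hBR
    have hGat : DifferentiableAt ℂ G (cplxVecL (ιA S T B)) := hGd.differentiableAt (isOpen_ball.mem_nhds hmem)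
    have h1 : DifferentiableAt ℝ (fun B' : VecField P k E3 => Complex.reCLM (G (cplxVecL B'))) (ιA S T B) :=
      Complex.reCLM.differentiableAt.comp _ ((hGat.restrictScalars ℝ).comp _ (cplxVecL (P := P) (k := k)).differentiableAt)
    refine h1.congr_of_eventuallyEq ?_
    have hopen : IsOpen {B' : VecField P k E3 | ‖B'‖ < R} := isOpen_lt continuous_norm continuous_const
    filter_upwards [hopen.mem_nhds hBR] with B' hB'
    simp only [cplxVecL_apply, hGr B' hB', Complex.reCLM_apply, Complex.ofReal_re]
  refine ⟨ha, fun X δ hX => ?_, prop4Hyp_taylorRemainder S T hR hGsd hGsb, fun u hu => ?_⟩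
  · -- (b) the first-variation formula
    have hgX : DifferentiableAt ℝ (sliceFn S T f V) X :=
      differentiableAt_of_cplx S T (hGsd.differentiableAt (isOpen_ball.mem_nhds (cplxSlice_mem_ball S T hX)))
        (eventually_agree_of_ball S T hGsr hX)
    rw [← inner_rGrad_eq_taylor S T (sliceFn S T f V) _ (fderiv ℝ (rGrad S T (sliceFn S T f V)) 0)]
    exact hasDerivAt_line_rGrad S T hgX δ
  · -- (d) the complex remainder restricts to the real one
    have h0 : ‖(0 : GaugeSlice S T E3)‖ < R := by rwa [norm_zero]
    have hu' := cGrad_cplxSlice S T (hGsd.differentiableAt (isOpen_ball.mem_nhds (cplxSlice_mem_ball S T hu)))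
      (eventually_agree_of_ball S T hGsr hu)
    have h0' := cGrad_cplxSlice S T (hGsd.differentiableAt (isOpen_ball.mem_nhds (cplxSlice_mem_ball S T h0)))
      (eventually_agree_of_ball S T hGsr h0)
    rw [map_zero] at h0'
    rw [hu', h0', fderiv_cGrad_cplxSlice S T hR hGsd hGsr u, ← map_sub, ← map_sub]

end Bonds

end Literature.MathematicalPhysics.QuantumFieldTheory.Balaban1983to89.B15Prop1SliceTaylorCalculus

end
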